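import Mathlib
import Literature.Combinatorics.Enumerative.EulerianExponentialGeneratingFunction
import Literature.Combinatorics.Enumerative.EulerZigzagGeneratingFunction
import HarnessLib

/-!
# Euler's evaluation of the Eulerian polynomials at `−1`: `A₂ₙ(−1) = 0`, `(−1)ⁿA₂ₙ₊₁(−1) = T₂ₙ₊₁`

Topic `Combinatorics/Enumerative`, namespace `Literature.Combinatorics.Enumerative`; THEOREMS ONLY (no
definition, no named fact, no `sorry`).  A junction of three stories of the tree: the Eulerian polynomials
`eulerianPolynomial R n = Σₖ A_{n,k} xᵏ` and their exponential generating function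
(`EulerianExponentialGeneratingFunction.lean`, Bóna's Theorem 1.23), the Brent–Zimmermann tangent numbers
and the formal series of `tanh` (`Literature.ComputerArithmetic.BrentZimmermann2010.TangentNumbers`), and the
Euler zigzag numbers `eulerZigzag` (`AlternatingPermutations.lean`, `EulerZigzagGeneratingFunction.lean`:
`E₂ₖ₋₁ = T_k`).

## Source, verbatim

D. Foata, G.-N. Han, *Doubloons and new q-tangent numbers*, Quart. J. Math. 62 (2011) 417–432
[FoataHan2011Doubloons], §1 Introduction (galaxy pdf:6708636292858075940 p. 1):

> In his search for an evaluation of the alternating sum `Σ_{i=1}^{m} (−1)^i iⁿ` Euler [Eu1755] introduced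
> the sequence of now called *Eulerian polynomials* `(Aₙ(t))` (`n ≥ 0`) in the following two equivalent
> forms: (1.1) `(t−1)/(t − exp(u(t−1))) = Σ_{n≥0} uⁿ/n! Aₙ(t) = 1 + u/1! + u²/2! (t+1) + u³/3! (t²+4t+1) +
> u⁴/4! (t³+11t²+11t+1) + ⋯` […] He also knew how to write the now called Taylor expansion of `tan u` as
> (1.4) `tan u = Σ_{n≥0} u^{2n+1}/(2n+1)! T_{2n+1} = u/1! + u³/3! 2 + u⁵/5! 16 + u⁷/7! 272 + ⋯`.  As
> `tan u = (1/i)(1 − e^{−2iu})/(1 + e^{−2iu})`, also equal to `Σ_{n≥1} uⁿ/n! i^{n−1} Aₙ(−1)` by (1.1), he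
> derived the relations
> (1.5)  `A₂ₙ(−1) = 0 (n ≥ 1);   (−1)ⁿ A₂ₙ₊₁(−1) = T₂ₙ₊₁ (n ≥ 0)`.

(Foata–Han's `Aₙ(t) = 1, 1, t+1, t²+4t+1, …` is the tree's `eulerianPolynomial R n` — Lothaire's indexing
`Σₖ A_{n,k}tᵏ`, `A_{n,k}` = number of permutations of `n` letters with `k` descents; their `T₂ₙ₊₁` is the
`(2n+1)`st tangent number, the tree's `TangentNumbers.T (n+1)` = `eulerZigzag (2n+1)`.)

## What is formalized

* ★ `eulerian_egf_at_neg_one` — (1.1) at `t = −1` in `ℚ⟦u⟧`, REAL form of Euler's complex computation: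
  `Σ_{n≥0} Aₙ(−1) uⁿ/n! = 1 + tanh u` (from the tree's `eulerian_egf_mul_eq` and `TangentNumbers.tanhSeries`).
* ★★ `eval_neg_one_eulerianPolynomial` — all of (1.5) at once: `Aₙ(−1) = 0` for even `n ≥ 2` and
  `A₂ₖ₋₁(−1) = (−1)^{k−1} T_k`; the printed clauses `eulerianPolynomial_two_mul_eval_neg_one` (`A₂ₙ(−1) = 0`,
  `n ≥ 1`) and `eulerianPolynomial_two_mul_add_one_eval_neg_one` (`(−1)ⁿA₂ₙ₊₁(−1) = T₂ₙ₊₁ = E₂ₙ₊₁`);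
  the alternating sums of Eulerian numbers `Σₖ (−1)ᵏ A_{2n,k} = 0`, `Σₖ (−1)ᵏ A_{2n+1,k} = (−1)ⁿ E₂ₙ₊₁`
  (`alternating_sum_eulerianNumber_even` / `_odd`).

## References

* [FoataHan2011Doubloons] D. Foata, G.-N. Han, *Doubloons and new q-tangent numbers*, Quart. J. Math. 62
  (2011), 417–432, §1 (1.1), (1.4), (1.5).
* L. Euler, *Institutiones calculi differentialis* (1755), Part II, Chap. VII (the original, as cited there).
* [Bona2012] M. Bóna, *Combinatorics of Permutations*, 2nd ed., §1.1.4 Theorem 1.23 (the generating function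
  (1.1), the tree's `eulerian_egf_mul_eq`).
* [BrentZimmermann2010] R. P. Brent, P. Zimmermann, *Modern Computer Arithmetic*, §4.7.2 (tangent numbers).
-/

namespace Literature.Combinatorics.Enumerative

-- `_root_`: the Eulerian files declare `Literature.Combinatorics.Enumerative.PowerSeries.coeff_one_sub_X_pow'`,
-- which would shadow `open PowerSeries` inside this namespace.
open _root_.PowerSeries _root_.Polynomial Finset
open scoped Nat
open Literature.ComputerArithmetic.BrentZimmermann2010
open Literature.Combinatorics.Words

/-- ★ **(1.1) at `t = −1`**: `Σ_{n≥0} Aₙ(−1) uⁿ/n! = 2/(1 + e^{−2u}) = 1 + tanh u` in `ℚ⟦u⟧` (Euler's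
`tan u = (1/i)(1−e^{−2iu})/(1+e^{−2iu})` read at `iu`). [cite: FoataHan2011Doubloons, §1 (1.1) and the derivation of (1.5)] -/
theorem eulerian_egf_at_neg_one :
    (PowerSeries.mk fun n : ℕ => (1 / n ! : ℚ) * (eulerianPolynomial ℚ n).eval (-1)) =
      1 + TangentNumbers.tanhSeries := by
  have h := eulerian_egf_mul_eq ℚ (-1 : ℚ)
  have hid : (PowerSeries.mk fun n : ℕ => algebraMap ℚ ℚ (1 / n !) * (eulerianPolynomial ℚ n).eval (-1)) =
      PowerSeries.mk fun n : ℕ => (1 / n ! : ℚ) * (eulerianPolynomial ℚ n).eval (-1) := by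
    ext n; simp
  rw [hid, show (1 : ℚ) - (-1) = 2 by norm_num, map_neg, map_one, neg_mul, one_mul, sub_neg_eq_add]
    at h
  have h2 : (PowerSeries.C (2 : ℚ)) = 2 := map_ofNat _ 2
  rw [h2] at h
  -- `eax 2 = rescale 2 exp`; the tree's `tanh · (e^{2u} + 1) = e^{2u} − 1`
  have hT := TangentNumbers.tanhSeries_mul
  rw [TangentNumbers.eax] at hT
  have hne : rescale (2 : ℚ) (exp ℚ) + 1 ≠ 0 := by
    intro h0
    apply TangentNumbers.constantCoeff_eax_two_add_one
    rw [TangentNumbers.eax, h0, map_zero]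
  have key : ((PowerSeries.mk fun n : ℕ => (1 / n ! : ℚ) * (eulerianPolynomial ℚ n).eval (-1)) -
      (1 + TangentNumbers.tanhSeries)) * (rescale (2 : ℚ) (exp ℚ) + 1) = 0 := by
    linear_combination h - hT
  exact sub_eq_zero.1 ((mul_eq_zero.1 key).resolve_right hne)

/-- ★★ **Euler's (1.5), both clauses**: `Aₙ(−1) = 0` for even `n ≥ 2` and `Aₙ(−1) = (−1)^{(n−1)/2} T_{(n+1)/2}`
for odd `n` (`T_k` the Brent–Zimmermann tangent numbers, `tan x = Σ T_k x^{2k−1}/(2k−1)!`); `A₀(−1) = 1`.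
[cite: FoataHan2011Doubloons, §1 (1.5)] -/
theorem eval_neg_one_eulerianPolynomial (n : ℕ) :
    (eulerianPolynomial ℚ n).eval (-1) =
      if n = 0 then 1 else if n % 2 = 1 then (-1) ^ (n / 2) * (TangentNumbers.T (n / 2 + 1) : ℚ) else 0 := by
  have h := congrArg (PowerSeries.coeff n) eulerian_egf_at_neg_one
  rw [PowerSeries.coeff_mk, map_add, PowerSeries.coeff_one, TangentNumbers.tanhSeries_eq_mk,
    PowerSeries.coeff_mk] at h
  have hfac : (n ! : ℚ) ≠ 0 := by positivity
  have h' : (eulerianPolynomial ℚ n).eval (-1) =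
      n ! * ((if n = 0 then 1 else 0) +
        if n % 2 = 1 then (-1) ^ (n / 2) * (TangentNumbers.T (n / 2 + 1) : ℚ) / n ! else 0) := by
    rw [← h]; field_simp
  rw [h']
  by_cases h0 : n = 0
  · subst h0; simp
  · rw [if_neg h0, if_neg h0, zero_add]
    split_ifs
    · field_simp
    · rw [mul_zero]

/-- **(1.5), first clause**: `A₂ₙ(−1) = 0` for `n ≥ 1`. [cite: FoataHan2011Doubloons, §1 (1.5) («A_{2n}(−1) = 0 (n ≥ 1)»)] -/
theorem eulerianPolynomial_two_mul_eval_neg_one {n : ℕ} (hn : 1 ≤ n) :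
    (eulerianPolynomial ℚ (2 * n)).eval (-1) = 0 := by
  rw [eval_neg_one_eulerianPolynomial, if_neg (by omega), if_neg (by omega)]

/-- **(1.5), second clause**: `(−1)ⁿ A₂ₙ₊₁(−1) = T₂ₙ₊₁`, the `(2n+1)`st tangent number — here as the Euler
zigzag number `E₂ₙ₊₁` (the number of alternating permutations of `2n+1` letters; `= TangentNumbers.T (n+1)`
by `eulerZigzag_two_mul_sub_one_eq_T`).
[cite: FoataHan2011Doubloons, §1 (1.5) («(−1)ⁿ A_{2n+1}(−1) = T_{2n+1} (n ≥ 0)»)] -/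
theorem eulerianPolynomial_two_mul_add_one_eval_neg_one (n : ℕ) :
    (-1) ^ n * (eulerianPolynomial ℚ (2 * n + 1)).eval (-1) = eulerZigzag (2 * n + 1) := by
  rw [eval_neg_one_eulerianPolynomial, if_neg (by omega), if_pos (by omega),
    show (2 * n + 1) / 2 = n by omega, show 2 * n + 1 = 2 * (n + 1) - 1 by omega,
    eulerZigzag_two_mul_sub_one_eq_T (by omega : 1 ≤ n + 1), ← mul_assoc, ← mul_pow]
  norm_num

/-- The same with the Brent–Zimmermann tangent number: `(−1)ⁿ A₂ₙ₊₁(−1) = T_{n+1}`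
(`tan x = Σ_k T_k x^{2k−1}/(2k−1)!`). [cite: FoataHan2011Doubloons, §1 (1.4)–(1.5); BrentZimmermann2010, §4.7.2 Eqn. (4.61)] -/
theorem eulerianPolynomial_two_mul_add_one_eval_neg_one_T (n : ℕ) :
    (-1) ^ n * (eulerianPolynomial ℚ (2 * n + 1)).eval (-1) = TangentNumbers.T (n + 1) := by
  rw [eulerianPolynomial_two_mul_add_one_eval_neg_one, show 2 * n + 1 = 2 * (n + 1) - 1 by omega,
    eulerZigzag_two_mul_sub_one_eq_T (by omega : 1 ≤ n + 1)]

/-- `Aₙ(−1) = Σₖ (−1)ᵏ A_{n,k}` (the alternating sum of a row of Eulerian numbers).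
[cite: FoataHan2011Doubloons, §1 (1.1) (A_n(t) = 1, 1, t+1, t²+4t+1, …)] -/
theorem eval_neg_one_eulerianPolynomial_eq_sum (R : Type*) [CommRing R] (n : ℕ) :
    (eulerianPolynomial R n).eval (-1) = ∑ k ∈ range (n + 1), (-1 : R) ^ k * eulerianNumber n k := by
  rw [eulerianPolynomial_def, eval_finsetSum]
  refine sum_congr rfl fun k _ => ?_
  rw [eval_mul, eval_pow, eval_X, eval_natCast, mul_comm]

/-- ★ **Even rows**: `Σₖ (−1)ᵏ A_{2n,k} = 0` for `n ≥ 1` — as many permutations of `2n` letters have an even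
as an odd number of descents. [cite: FoataHan2011Doubloons, §1 (1.5) («A_{2n}(−1) = 0»)] -/
theorem alternating_sum_eulerianNumber_even {n : ℕ} (hn : 1 ≤ n) :
    ∑ k ∈ range (2 * n + 1), (-1 : ℤ) ^ k * eulerianNumber (2 * n) k = 0 := by
  have h := eulerianPolynomial_two_mul_eval_neg_one hn
  rw [eval_neg_one_eulerianPolynomial_eq_sum] at h
  exact_mod_cast h

/-- ★ **Odd rows**: `Σₖ (−1)ᵏ A_{2n+1,k} = (−1)ⁿ E₂ₙ₊₁` — the signed count of the permutations of `2n+1`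
letters by parity of the number of descents is, up to sign, the number of alternating ones.
[cite: FoataHan2011Doubloons, §1 (1.5) («(−1)ⁿ A_{2n+1}(−1) = T_{2n+1}»)] -/
theorem alternating_sum_eulerianNumber_odd (n : ℕ) :
    ∑ k ∈ range (2 * n + 2), (-1 : ℤ) ^ k * eulerianNumber (2 * n + 1) k = (-1) ^ n * eulerZigzag (2 * n + 1) := by
  have h := eulerianPolynomial_two_mul_add_one_eval_neg_one n
  rw [eval_neg_one_eulerianPolynomial_eq_sum] at h
  have hs : ((-1 : ℚ) ^ n) * (-1) ^ n = 1 := by rw [← mul_pow]; norm_num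
  have h' : ∑ k ∈ range (2 * n + 1 + 1), (-1 : ℚ) ^ k * eulerianNumber (2 * n + 1) k =
      (-1) ^ n * eulerZigzag (2 * n + 1) := by
    rw [← h, ← mul_assoc, hs, one_mul]
  exact_mod_cast h'

/-- The first instances: `A₁(−1), …, A₇(−1) = 1, 0, −2, 0, 16, 0, −272` (`T₃ = 2`, `T₅ = 16`, `T₇ = 272`).
[cite: FoataHan2011Doubloons, §1 (1.4)–(1.5)] -/
theorem eval_neg_one_eulerianPolynomial_values :
    [(eulerianPolynomial ℚ 1).eval (-1), (eulerianPolynomial ℚ 2).eval (-1), (eulerianPolynomial ℚ 3).eval (-1),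
      (eulerianPolynomial ℚ 4).eval (-1), (eulerianPolynomial ℚ 5).eval (-1), (eulerianPolynomial ℚ 6).eval (-1),
      (eulerianPolynomial ℚ 7).eval (-1)] = [1, 0, -2, 0, 16, 0, -272] := by
  have hT := TangentNumbers.T_table
  simp only [List.map, List.range, List.range.loop, List.cons.injEq, and_true] at hT
  obtain ⟨-, h1, h2, h3, h4, -, -, -⟩ := hT
  simp only [eval_neg_one_eulerianPolynomial]
  norm_num [h1, h2, h3, h4]

end Literature.Combinatorics.Enumerative
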